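import Literature.Geometry.ComplexAnalytic.RelativeExponentialChartSectionReading        -- ★ FLAT-b(i) core `sectionReading_const`
import Literature.Geometry.ComplexAnalytic.RelativeExponentialUniformisation             -- ★ `totalOver`, `projOver`, `basePoint`
import Literature.AlgebraicGeometry.AbelianSchemes.AbelianSchemeOverRestrictPt            -- ★ `restrictPt_pow_eq_one`, `restrict_left`
import Literature.AlgebraicGeometry.AbelianSchemes.AbelianSchemeFibreHom                  -- ★ `fibrePointToLeft_injective`
import Literature.AlgebraicGeometry.AbelianSchemes.PolarizedAbelianSchemeWithLevel
import Literature.Geometry.Kaehler.ComplexTorusCover                                     -- ★ `ComplexTorus.cover`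
import HarnessLib

/-!
# The LEVEL SECTIONS of an analytified abelian scheme read a CONSTANT rational vector through a relative exponential chart
# ([BirkenhakeLange2004] §8.7 Lemma 8.7.1; [DeligneHodgeII1971] §4.4 (4.4.2); [MumfordFogartyKirwan1994] Def. 7.1)

Layer `Literature/AlgebraicGeometry/ModuliOfAbelianVarieties` (abelian-scheme currency, filed next to its L7 consumers); namespace
`Literature.AlgebraicGeometry.ModuliOfAbelianVarieties.RelativeExponentialChartLevelReadings`.  THEOREMS ONLY (no definition, no named fact, no
instance, no notation, no `sorry`).  Cell `hodgecm-mathlib` (D-0151), FLOOR 0, P6 «MOD» (crux hLiu418 = stmt-HodgeConjecture-24832, `--supports`),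
half A line L7, socket `stub_UNIVFAM` (★ P-3), organ O3 `stub_FLAT`, sub-organ **FLAT-b(i) «LEVEL READINGS CONSTANT ALONG A CHART»** —
the HEAD in the currency of LA7-p01 (g0)'s FLAT-b ⇄ FLAT-c interface v1, conclusion (L=) token for token (LA7-plan RULING 2026-09-02T02:22Z).
HC_CM is proved only modulo the printed citations until rung 0 closes; this file is count-neutral.

THE MATHEMATICS.  Let `A → T` be an abelian scheme over a complex variety with analytifications `φT : MT → T(ℂ)`, `φA : MA → A(ℂ)` (★
`IsAnalytification`), and let `(Φ₁, ex₁)` be a relative exponential chart (★ `IsRelExpChartOn`) of the analytic projection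
`basePoint hT A φA : MA → MT` over a preconnected `V`, with (G): every fibre map `ex₁ (t, ·)` descends to an ADDITIVE analytification `φt` of the
algebraic fibre `A_t`.  An algebraic section `σ` of `A → T` with `σ^m = 1` (`m ≠ 0`; e.g. a level section, [MumfordFogartyKirwan1994] Def. 7.1
(ii) `ψ_n ∘ σᵢ = ε`) gives a CONTINUOUS section `t ↦ φA⁻¹ (σ (φT t))` of the analytic family (regular maps are continuous on complex points),
whose chart readings are `m`-division vectors of the lattice (additivity of `φt`: `σ(t)` is `m`-torsion in `A_t(ℂ)`), hence — ★ core
`IsRelExpChartOn.sectionReading_const` — CONSTANT: if `σ(t₀)` is the chart point `ex₁ (t₀, Φ₁ t₀ ṽ)` for a rational `v`, then `σ(t)` is the chart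
point `ex₁ (t, Φ₁ t ṽ)` for every `t ∈ V`.  This is [BirkenhakeLange2004] §8.7 Lemma 8.7.1 ∕ [DeligneHodgeII1971] (4.4.2) (torsion sections are
sections of the local system `R₁f_*ℤ ⊗ ℚ∕ℤ`) in the tree's quotient-free currency; the readings are stated, as in the interface, by the junction
`A.fibrePointToLeft (φT t).left (A.restrictPt (φT t).left σ) = (φA (ex₁ (t, Φ₁ t ṽ))).left`.

* `torsionSectionReading_const` — for any section `σ` with `σ ^ m = 1`, `m ≠ 0`;
* `levelReading_const` — for the level sections `P.level.σ i` of a polarised abelian scheme with level-`N` structure (`N ≠ 0`): interface (L=).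

## References
* [BirkenhakeLange2004] C. Birkenhake, H. Lange, *Complex Abelian Varieties*, 2nd ed. (2004), Ch. 8 §8.7 Lemma 8.7.1 pp. 229–231.
* [DeligneHodgeII1971] P. Deligne, *Théorie de Hodge II*, Publ. Math. IHÉS 40 (1971), §4.4 (4.4.2) p. 50.
* [MumfordFogartyKirwan1994] D. Mumford, J. Fogarty, F. Kirwan, *Geometric Invariant Theory*, 3rd ed. (1994), Ch. 7 §2 Definition 7.1 (p. 129).
-/

set_option autoImplicit false

noncomputable section

open CategoryTheory CategoryTheory.Limits AlgebraicGeometry Topology Set Function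
open scoped Manifold MonObj
open Literature.AlgebraicGeometry.Motives (SchemeOver ComplexPoints AlgPoints specOver AbelianVariety)
open Literature.AlgebraicGeometry.AbelianSchemes (PolarizedAbelianSchemeWithLevel AbelianSchemeOver)
open Literature.Geometry.Kaehler (ComplexTorus)
open Literature.Geometry.Kaehler.ComplexTorus (cover proj)
open Literature.Geometry.ComplexAnalytic (IsRelExpChartOn totalOver projOver basePoint)
open Literature.NumberTheory.Transcendental (IsAnalytification)

namespace Literature.AlgebraicGeometry.ModuliOfAbelianVarieties

namespace RelativeExponentialChartLevelReadings

variable {g d : ℕ} {T : SchemeOver ℂ}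
  {MT : Type} [TopologicalSpace MT] [ChartedSpace (Fin d → ℂ) MT] {φT : MT → ComplexPoints T}
  {MA : Type} [TopologicalSpace MA] [ChartedSpace (Fin (d + g) → ℂ) MA]

/-- Powers of an additive map from the torus: `φ (m • τ) = (φ τ) ^ m` (plumbing). [folklore] -/
private theorem map_nsmul_eq_pow {Φ : (Fin g ⊕ Fin g → ℝ) ≃L[ℝ] (Fin g → ℂ)} {G : Type*} [Group G]
    (φ : ComplexTorus Φ → G) (hadd : ∀ x y, φ (x + y) = φ x * φ y) (τ : ComplexTorus Φ) (m : ℕ) : φ (m • τ) = φ τ ^ m := by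
  have h0 : φ 0 = 1 := by
    have h := hadd 0 0
    rw [add_zero] at h
    exact (mul_eq_left.1 h.symm)
  induction m with
  | zero => simp [h0]
  | succ k ih => rw [succ_nsmul, hadd, ih, pow_succ]

/-- An element of the real torus killed by `m` lifts to an `m`-division vector (plumbing). [folklore] -/
private theorem exists_isDiv_of_nsmul_eq_zero {Φ : (Fin g ⊕ Fin g → ℝ) ≃L[ℝ] (Fin g → ℂ)} {τ : ComplexTorus Φ} {m : ℕ}
    (hτ : m • τ = 0) : ∃ x : Fin g ⊕ Fin g → ℝ, (∀ i, ∃ k : ℤ, (m : ℝ) * x i = k) ∧ proj Φ x = τ := by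
  refine ⟨ComplexTorus.lift Φ τ, fun i => ?_, ComplexTorus.proj_lift Φ τ⟩
  have hi : m • ((τ : (Fin g ⊕ Fin g) → AddCircle (1 : ℝ)) i) = 0 :=
    congrArg (fun f : ComplexTorus Φ => (f : (Fin g ⊕ Fin g) → AddCircle (1 : ℝ)) i) hτ
  have hlift : ((ComplexTorus.lift Φ τ i : ℝ) : AddCircle (1 : ℝ)) = (τ : (Fin g ⊕ Fin g) → AddCircle (1 : ℝ)) i := by
    have := congrArg (fun f : ComplexTorus Φ => (f : (Fin g ⊕ Fin g) → AddCircle (1 : ℝ)) i) (ComplexTorus.proj_lift Φ τ)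
    simpa only [ComplexTorus.proj_apply] using this
  have h2 : ((((m : ℝ) * ComplexTorus.lift Φ τ i : ℝ)) : AddCircle (1 : ℝ)) = 0 := by
    rw [← nsmul_eq_mul, AddCircle.coe_nsmul, hlift]
    exact hi
  obtain ⟨k, hk⟩ := (AddCircle.coe_eq_zero_iff (1 : ℝ)).1 h2
  exact ⟨k, by rw [← hk, zsmul_eq_mul, mul_one]⟩

/-- **A TORSION SECTION OF AN ANALYTIFIED ABELIAN SCHEME READS A CONSTANT RATIONAL VECTOR THROUGH A RELATIVE EXPONENTIAL CHART**
([BirkenhakeLange2004] §8.7 Lemma 8.7.1; [DeligneHodgeII1971] (4.4.2)): chart `(Φ₁, ex₁)` of `basePoint hT A φA` over a preconnected `V` with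
additive fibre analytifications (G); an algebraic section `σ` of `A → T` with `σ ^ m = 1`, `m ≠ 0`; if at `t₀ ∈ V` the fibre point `σ(t₀)`
is the chart point `ex₁ (t₀, Φ₁ t₀ ṽ)`, then at every `t ∈ V` the fibre point `σ(t)` is the chart point `ex₁ (t, Φ₁ t ṽ)`.
[cite: BirkenhakeLange2004, §8.7 Lemma 8.7.1] [cite: DeligneHodgeII1971, §4.4 (4.4.2) p. 50] [cite: MumfordFogartyKirwan1994, Ch. 7 §2 Definition 7.1 (p. 129)] -/
theorem torsionSectionReading_const (A : AbelianSchemeOver T.left) (hT : IsAnalytification (Fin d → ℂ) T d φT)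
    (φA : MA → ComplexPoints (totalOver T A)) (hA : IsAnalytification (Fin (d + g) → ℂ) (totalOver T A) (d + g) φA)
    {V : Set MT} {Φ₁ : MT → ((Fin g ⊕ Fin g → ℝ) ≃L[ℝ] (Fin g → ℂ))} {ex₁ : MT × (Fin g → ℂ) → MA}
    (hex₁ : IsRelExpChartOn (Fin d → ℂ) (Fin (d + g) → ℂ) (basePoint hT A φA) V Φ₁ ex₁) (hV : IsPreconnected V)
    (hG : ∀ t ∈ V, ∃ φt : ComplexTorus (Φ₁ t) → (A.fibre (φT t).left).toAbelianVariety.Points ℂ,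
      IsAnalytification (Fin g → ℂ) (A.fibre (φT t).left).toAbelianVariety.X g φt ∧
      (∀ x y, φt (x + y) = φt x * φt y) ∧
      ∀ z : Fin g → ℂ, (φA (ex₁ (t, z))).left = A.fibrePointToLeft (φT t).left (φt (cover (Φ₁ t) z)))
    (σ : A.Sections) {m : ℕ} (hm : m ≠ 0) (hσ : σ ^ m = 1)
    {t₀ t : MT} (ht₀ : t₀ ∈ V) (ht : t ∈ V) (v : Fin g ⊕ Fin g → ℚ)
    (h₀ : A.fibrePointToLeft (φT t₀).left (A.restrictPt (φT t₀).left σ) = (φA (ex₁ (t₀, Φ₁ t₀ (fun j => (v j : ℝ))))).left) :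
    A.fibrePointToLeft (φT t).left (A.restrictPt (φT t).left σ) = (φA (ex₁ (t, Φ₁ t (fun j => (v j : ℝ))))).left := by
  -- the section as a morphism of `ℂ`-schemes `T → A` over `T`, and the induced continuous section `S : MT → MA`
  have hw : (σ.left : T.left ⟶ A.X.left) ≫ (totalOver T A).hom = T.hom := by
    change σ.left ≫ A.X.hom ≫ T.hom = T.hom
    rw [← Category.assoc]
    erw [Over.w σ]
    exact Category.id_comp _
  let secHom : T ⟶ totalOver T A := Over.homMk σ.left hw
  let S : MT → MA := fun t' => hA.homeomorph.symm (AlgPoints.map secHom (φT t'))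
  have hS : ∀ t', φA (S t') = AlgPoints.map secHom (φT t') := fun t' => by
    change hA.homeomorph (hA.homeomorph.symm _) = _
    exact hA.homeomorph.apply_symm_apply _
  have hSleft : ∀ t', (φA (S t')).left = (φT t').left ≫ σ.left := fun t' => by rw [hS]; rfl
  -- the fibre-point reading of the section: `fibrePointToLeft (σ(t)) = (φT t) ≫ σ`
  have hread : ∀ t', A.fibrePointToLeft (φT t').left (A.restrictPt (φT t').left σ) = (φT t').left ≫ σ.left := fun t' => by
    change (A.restrictPt (φT t').left σ).left ≫ pullback.fst _ _ = _
    exact A.restrictPt_left_fst (φT t').left σ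
  -- dictionary: «`σ(t')` is the chart point at `z`» ⟺ `S t' = ex₁ (t', z)`
  have hdict : ∀ t' (z : Fin g → ℂ), (A.fibrePointToLeft (φT t').left (A.restrictPt (φT t').left σ) = (φA (ex₁ (t', z))).left ↔
      S t' = ex₁ (t', z)) := fun t' z => by
    rw [hread, ← hSleft]
    exact ⟨fun h => hA.isHomeomorph.injective (Over.OverMorphism.ext h), fun h => by rw [h]⟩
  -- `S` is continuous and lies over the base
  have hSc : Continuous S :=
    hA.homeomorph.symm.continuous.comp ((AlgPoints.continuous_map secHom).comp hT.isHomeomorph.continuous)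
  have hpS : ∀ t', basePoint hT A φA (S t') = t' := fun t' => by
    apply hT.homeomorph.injective
    rw [IsAnalytification.coe_homeomorph, Literature.Geometry.ComplexAnalytic.apply_basePoint hT A φA (S t'), hS,
      ← AlgPoints.map_comp_apply]
    have hid : secHom ≫ projOver T A = 𝟙 T := by
      ext : 1
      change σ.left ≫ A.X.hom = 𝟙 T.left
      erw [Over.w σ]
      rfl
    rw [hid, AlgPoints.map_id_apply]
  -- the readings of `S` are `m`-division vectors (additivity of the fibre analytification; `σ(t)` is `m`-torsion)
  have hdiv : ∀ t' ∈ V, ∃ x : Fin g ⊕ Fin g → ℝ, (∀ i, ∃ k : ℤ, (m : ℝ) * x i = k) ∧ S t' = ex₁ (t', Φ₁ t' x) := by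
    intro t' ht'
    obtain ⟨φt, hφt, hadd, hcomp⟩ := hG t' ht'
    have hQm : (A.restrictPt (φT t').left σ : (A.fibre (φT t').left).toAbelianVariety.Points ℂ) ^ m = 1 :=
      A.restrictPt_pow_eq_one (φT t').left hσ
    obtain ⟨τ, hτ⟩ := hφt.isHomeomorph.surjective (A.restrictPt (φT t').left σ)
    have h1 : φt 0 = 1 := by
      have := map_nsmul_eq_pow φt hadd 0 0
      rwa [zero_nsmul, pow_zero] at this
    have hτm : m • τ = 0 := by
      apply hφt.isHomeomorph.injective
      rw [map_nsmul_eq_pow φt hadd τ m, hτ, h1]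
      exact hQm
    obtain ⟨x, hxdiv, hxτ⟩ := exists_isDiv_of_nsmul_eq_zero hτm
    refine ⟨x, hxdiv, (hdict t' (Φ₁ t' x)).1 ?_⟩
    rw [hcomp, ComplexTorus.cover_apply_apply, hxτ, hτ]
  -- the core: constant reading on the preconnected `V`
  have h₀' : S t₀ = ex₁ (t₀, Φ₁ t₀ (fun j => (v j : ℝ))) := (hdict t₀ _).1 h₀
  exact (hdict t _).2 (hex₁.sectionReading_const Subset.rfl hV hSc.continuousOn (fun t' _ => hpS t') hm hdiv ht₀ h₀' t ht)

/-- **FLAT-b(i) (L=): THE LEVEL SECTIONS READ A CONSTANT RATIONAL VECTOR THROUGH THE CHART** — for a polarised abelian scheme with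
level-`N` structure `P` over `T` (`N ≠ 0`), a chart `(Φ₁, ex₁)` of `(P.A)^an → T^an` over a preconnected `V` with (G), every `i` and every
rational `v`: if the level section `σᵢ` reads `ṽ` at `t₀ ∈ V`, it reads `ṽ` at every `t ∈ V` (interface (L=) of LA7-p01 (g0)'s FLAT-c, token
for token).  [MumfordFogartyKirwan1994] Def. 7.1 (ii): `σᵢ ^ N = 1`.
[cite: BirkenhakeLange2004, §8.7 Lemma 8.7.1] [cite: MumfordFogartyKirwan1994, Ch. 7 §2 Definition 7.1 (p. 129)] [cite: DeligneHodgeII1971, §4.4 (4.4.2) p. 50] -/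
theorem levelReading_const {N : ℕ} {δ : Fin g → ℕ} (hN : N ≠ 0) (P : PolarizedAbelianSchemeWithLevel g N δ T.left)
    (hT : IsAnalytification (Fin d → ℂ) T d φT)
    (φA : MA → ComplexPoints (totalOver T P.A)) (hA : IsAnalytification (Fin (d + g) → ℂ) (totalOver T P.A) (d + g) φA)
    {V : Set MT} {Φ₁ : MT → ((Fin g ⊕ Fin g → ℝ) ≃L[ℝ] (Fin g → ℂ))} {ex₁ : MT × (Fin g → ℂ) → MA}
    (hex₁ : IsRelExpChartOn (Fin d → ℂ) (Fin (d + g) → ℂ) (basePoint hT P.A φA) V Φ₁ ex₁) (hV : IsPreconnected V)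
    (hG : ∀ t ∈ V, ∃ φt : ComplexTorus (Φ₁ t) → (P.A.fibre (φT t).left).toAbelianVariety.Points ℂ,
      IsAnalytification (Fin g → ℂ) (P.A.fibre (φT t).left).toAbelianVariety.X g φt ∧
      (∀ x y, φt (x + y) = φt x * φt y) ∧
      ∀ z : Fin g → ℂ, (φA (ex₁ (t, z))).left = P.A.fibrePointToLeft (φT t).left (φt (cover (Φ₁ t) z)))
    {t₀ t : MT} (ht₀ : t₀ ∈ V) (ht : t ∈ V) :
    ∀ (i : Fin g ⊕ Fin g) (v : Fin g ⊕ Fin g → ℚ),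
      P.A.fibrePointToLeft (φT t₀).left (P.A.restrictPt (φT t₀).left (P.level.σ i)) =
          (φA (ex₁ (t₀, Φ₁ t₀ (fun j => (v j : ℝ))))).left →
      P.A.fibrePointToLeft (φT t).left (P.A.restrictPt (φT t).left (P.level.σ i)) =
          (φA (ex₁ (t, Φ₁ t (fun j => (v j : ℝ))))).left :=
  fun i v h₀ => torsionSectionReading_const P.A hT φA hA hex₁ hV hG (P.level.σ i) hN (P.level.pow_σ i) ht₀ ht v h₀

end RelativeExponentialChartLevelReadings

end Literature.AlgebraicGeometry.ModuliOfAbelianVarieties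

end
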